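import Literature.Topology.FourManifolds.MMSWTwistedPicture
import Literature.Topology.FourManifolds.MMSWStripTwist
import HarnessLib

/-!
# The picture of a strip-twisted model knot is an immersion (generic bands)

Sibling of `MMSWTwistedPicture.lean`, `MMSWStripTwist.lean` and `MMSWBandGenericity.lean`,
towards the named fact `Literature.Topology.FourManifolds.MMSW.eventually_approxHasRasmussen`
(Manolescu–Marengon–Sarkar–Willis, arXiv:1910.08195, Thm. 1.4 / Prop. 8.2 (i)); first step of
"the twisted pictures `D(0⃗)(stripTwistAt_k ∘ K)` are in general position" (MMSW §8.1 in the
tree's picture).  PROVED: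

* `norm_stripMultiplierAt`, `IsModelKnot.stripTwistAt_comp`, `wC_stripTwistAt_ne_zero` — the
  offset strip twist of a (core-missing) model knot is a (core-missing) model knot;
* `deriv_planeCurve_twisted_ne_zero` — **if the picture `D(0⃗)(K)` is an immersion and no
  critical value of `Re z` along `K` lies in a band window, then the picture of
  `stripTwistAt r k w e ∘ K` is an immersion, for EVERY `k`**: off the (closed) windows the
  multiplier is `1` near the parameter, so the two plane curves agree nearby; inside a window the
  planar radius `Re z + C_r` of the twisted picture has nonzero derivative.

## References

* C. Manolescu, M. Marengon, S. Sarkar, M. Willis, Duke Math. J. 172 (2023), arXiv:1910.08195,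
  §2.1 and §8.1. [ManolescuMarengonSarkarWillis2023]
-/

open scoped Manifold ContDiff Topology ComplexConjugate
open Function Set Filter Complex

noncomputable section

namespace Literature.Topology.FourManifolds

/-- Local notation: `𝔼 n` is the model Euclidean space `EuclideanSpace ℝ (Fin n)`. -/
local notation "𝔼 " n:arg => EuclideanSpace ℝ (Fin n)

/-- Local notation: `𝕊 n` is the unit sphere in `EuclideanSpace ℝ (Fin (n + 1))`. -/
local notation "𝕊 " n:arg => (Metric.sphere (0 : EuclideanSpace ℝ (Fin (n + 1))) 1)

namespace MMSW

open Literature.AlgebraicTopology.Homotopy.HopfFibration (zC wC ofZW zC_ofZW wC_ofZW ofZW_zC_wC)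

variable {r : ℕ}

/-! ## The offset strip twist of a model knot -/

/-- The offset strip multiplier is a unit. [folklore] -/
theorem norm_stripMultiplierAt (k : ℤ) (w : ℝ) (e : Fin r → ℝ) (z : ℂ) :
    ‖stripMultiplierAt r k w e z‖ = 1 := by
  rw [stripMultiplierAt, norm_prod]
  exact Finset.prod_eq_one fun j _ ↦ norm_stripUnit _ _ _

/-- **The offset strip twist of a model knot is a model knot.** [cite: ManolescuMarengonSarkarWillis2023, §2.3] -/
theorem IsModelKnot.stripTwistAt_comp {K : 𝕊 1 → 𝔼 4} (hK : IsModelKnot r K) (k : ℤ) {w : ℝ}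
    (hw : 0 < w) {e : Fin r → ℝ} (he : ∀ j, |e j| + w < 1) :
    IsModelKnot r (stripTwistAt r k w e ∘ K) := by
  have he1 : ∀ j, |e j| < 1 := fun j ↦ by linarith [he j]
  have hz : ∀ t, ∀ j : Fin r, zC (K t) ≠ holeCentre r j := fun t ↦ zC_ne_holeCentre (hK.mem t).1
  rw [← fibreRot_stripFamilyAt_one_comp hK k w he1]
  refine hK.fibreRot_comp (fun t ↦ ?_) (fun t ↦ norm_stripFamilyAt (hz t) k w e 1)
  have h := contDiffAt_stripFamilyAt (one_le_norm_zC_sub_holeCentre (hK.mem t).1) k hw he 1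
  exact h.comp (zC (K t)) (contDiffAt_const.prodMk contDiffAt_id)

/-- The offset strip twist keeps a core-missing point core-missing. [folklore] -/
theorem wC_stripTwistAt_ne_zero (k : ℤ) (w : ℝ) (e : Fin r → ℝ) {x : 𝔼 4} (hx : wC x ≠ 0) :
    wC (stripTwistAt r k w e x) ≠ 0 := by
  rw [stripTwistAt, wC_fibreRot]
  exact mul_ne_zero hx (norm_ne_zero_iff.1 (by rw [norm_stripMultiplierAt]; exact one_ne_zero))

/-- `z` is unchanged by the offset strip twist. [folklore] -/
@[simp] theorem zC_stripTwistAt (k : ℤ) (w : ℝ) (e : Fin r → ℝ) (x : 𝔼 4) :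
    zC (stripTwistAt r k w e x) = zC x := by
  rw [stripTwistAt, zC_fibreRot]

/-! ## The planar radius of a picture knot -/

/-- The squared planar radius of the picture knot of a core-missing model knot is
`(Re z + C_r)²` along the knot. [folklore] -/
theorem planeCurve_sq_add_sq {K : 𝕊 1 → 𝔼 4} (hK : IsModelKnot r K) (hw : ∀ t, wC (K t) ≠ 0)
    {K₃ : Knot} (hK₃ : ⇑K₃ = finiteApprox r 0 K) (θ : ℝ) :
    (K₃.planeCurve θ).1 ^ 2 + (K₃.planeCurve θ).2 ^ 2 =
      ((zC (K (circlePoint θ))).re + drawRadius r) ^ 2 := by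
  have h := norm_chartC_stereoCurve hK hw hK₃ θ
  have h2 : ‖chartC (K₃.stereoCurve θ)‖ ^ 2 =
      (chartC (K₃.stereoCurve θ)).re ^ 2 + (chartC (K₃.stereoCurve θ)).im ^ 2 := by
    rw [Complex.sq_norm, Complex.normSq_apply]; ring
  rw [← h, h2, chartC_re, chartC_im, Knot.planeCurve_eq_fst_comp, comp_apply]

/-- If the plane curve has zero velocity at `θ` then so has its squared radius. [folklore] -/
theorem hasDerivAt_sq_add_sq_zero {K₃ : Knot} (hK : ∀ x, K₃ x ≠ northPole) {θ : ℝ}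
    (h0 : deriv K₃.planeCurve θ = 0) :
    HasDerivAt (fun t ↦ (K₃.planeCurve t).1 ^ 2 + (K₃.planeCurve t).2 ^ 2) 0 θ := by
  have hd : HasDerivAt K₃.planeCurve (deriv K₃.planeCurve θ) θ :=
    (((Knot.contDiff_planeCurve hK).differentiable (by simp)) θ).hasDerivAt
  rw [h0] at hd
  have h1 : HasDerivAt (fun t ↦ (K₃.planeCurve t).1) 0 θ := hd.fst
  have h2 : HasDerivAt (fun t ↦ (K₃.planeCurve t).2) 0 θ := hd.snd
  have h := (h1.pow 2).add (h2.pow 2)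
  have hfun : ((fun t ↦ (K₃.planeCurve t).1) ^ 2 + (fun t ↦ (K₃.planeCurve t).2) ^ 2) =
      fun t ↦ (K₃.planeCurve t).1 ^ 2 + (K₃.planeCurve t).2 ^ 2 := by
    funext t; simp
  rw [hfun] at h
  simpa using h

/-! ## The twisted picture is an immersion -/

/-- **The picture of an offset-strip-twisted model knot is an immersion** when the original
picture is and no critical value of `Re z` along the knot lies in a band window.
[cite: ManolescuMarengonSarkarWillis2023, §8.1] -/
theorem deriv_planeCurve_twisted_ne_zero {K : 𝕊 1 → 𝔼 4} (hK : IsModelKnot r K)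
    (hwK : ∀ t, wC (K t) ≠ 0) {K₃ K₃k : Knot} (hK₃ : ⇑K₃ = finiteApprox r 0 K) {k : ℤ} {w : ℝ}
    (hw : 0 < w) {e : Fin r → ℝ} (he : ∀ j, |e j| + w < 1)
    (hK₃k : ⇑K₃k = finiteApprox r 0 (stripTwistAt r k w e ∘ K))
    (himm : ∀ t, deriv K₃.planeCurve t ≠ 0)
    (hcrit : ∀ (j : Fin r) (θ : ℝ), deriv (fun θ : ℝ ↦ (zC (K (circlePoint θ))).re) θ = 0 →
      (zC (K (circlePoint θ))).re ∉
        Icc ((holeCentre r j).re + e j - w) ((holeCentre r j).re + e j + w)) :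
    ∀ t, deriv K₃k.planeCurve t ≠ 0 := by
  set f : ℝ → ℝ := fun θ ↦ (zC (K (circlePoint θ))).re with hf
  have hKk : IsModelKnot r (stripTwistAt r k w e ∘ K) := hK.stripTwistAt_comp k hw he
  have hwk : ∀ t, wC ((stripTwistAt r k w e ∘ K) t) ≠ 0 := fun t ↦
    wC_stripTwistAt_ne_zero k w e (hwK t)
  have hfc : Continuous f := by
    have h1 : Continuous fun θ : ℝ ↦ K (circlePoint θ) :=
      (contMDiff_iff_contDiff.1 (hK.1.comp contMDiff_circlePoint)).continuous
    exact Complex.continuous_re.comp ((contDiff_zC (n := ∞)).continuous.comp h1)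
  have hfd : Differentiable ℝ f := by
    have h1 : ContDiff ℝ ∞ fun θ : ℝ ↦ K (circlePoint θ) :=
      contMDiff_iff_contDiff.1 (hK.1.comp contMDiff_circlePoint)
    exact (Complex.reCLM.contDiff.comp (contDiff_zC.comp h1)).differentiable (by simp)
  intro θ
  by_cases hwin : ∃ j : Fin r, f θ ∈ Icc ((holeCentre r j).re + e j - w) ((holeCentre r j).re + e j + w)
  · -- inside a window: the radius `f + C_r` has nonzero derivative
    obtain ⟨j, hj⟩ := hwin
    have hf' : deriv f θ ≠ 0 := fun h0 ↦ hcrit j θ h0 hj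
    intro h0
    have hne : ∀ x, K₃k x ≠ northPole := fun x ↦ ne_northPole_of_coe_eq_finiteApprox hK₃k x
    have h1 := hasDerivAt_sq_add_sq_zero hne h0
    -- the same function is `(f + C_r)²`
    have heq : (fun t ↦ (K₃k.planeCurve t).1 ^ 2 + (K₃k.planeCurve t).2 ^ 2) =
        fun t ↦ (f t + drawRadius r) ^ 2 := by
      funext t
      rw [planeCurve_sq_add_sq hKk hwk hK₃k t, comp_apply, zC_stripTwistAt]
    rw [heq] at h1
    have h2 : HasDerivAt (fun t ↦ (f t + drawRadius r) ^ 2)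
        (2 * (f θ + drawRadius r) * deriv f θ) θ := by
      have h := ((hfd θ).hasDerivAt.add_const (drawRadius r)).pow 2
      have hfun : ((fun t ↦ f t + drawRadius r) ^ 2) = fun t ↦ (f t + drawRadius r) ^ 2 := by
        funext t; simp
      rw [hfun] at h
      refine h.congr_deriv ?_
      norm_num
    have h3 := h1.unique h2
    have hpos : 0 < f θ + drawRadius r := re_zC_add_drawRadius_pos (hK.mem _)
    have : 2 * (f θ + drawRadius r) * deriv f θ ≠ 0 := by positivity
    exact this h3.symm
  · -- off the windows: the multiplier is `1` near `θ`, the two pictures agree nearby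
    push Not at hwin
    have hev : ∀ᶠ t in 𝓝 θ, ∀ j : Fin r,
        w < |f t - (holeCentre r j).re - e j| := by
      refine eventually_all.2 fun j ↦ ?_
      have hj := hwin j
      rw [mem_Icc, not_and_or, not_le, not_le] at hj
      rcases hj with hlt | hgt
      · have h := hfc.continuousAt.eventually (Iio_mem_nhds hlt)
        filter_upwards [h] with t ht
        have ht' : f t < (holeCentre r j).re + e j - w := ht
        rw [lt_abs]; right; linarith
      · have h := hfc.continuousAt.eventually (Ioi_mem_nhds hgt)
        filter_upwards [h] with t ht
        have ht' : (holeCentre r j).re + e j + w < f t := ht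
        rw [lt_abs]; left; linarith
    have heq : K₃k.planeCurve =ᶠ[𝓝 θ] K₃.planeCurve := by
      filter_upwards [hev] with t ht
      refine planeCurve_twisted_eq_of_apply_eq_one (φ := stripMultiplierAt r k w e) hK₃ hK₃k ?_
      exact stripMultiplierAt_eq_one hw fun j ↦ Or.inr (ht j).le
    rw [heq.deriv_eq]
    exact himm θ

end MMSW

end Literature.Topology.FourManifolds

end
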